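import Mathlib.Analysis.InnerProductSpace.PiL2
import Mathlib.Analysis.Calculus.FDeriv.Equiv
import Mathlib.Algebra.GroupWithZero.Units.Fintype
import Mathlib.Data.Finite.Perm
import Mathlib.SetTheory.Cardinal.Finite
import Literature.Analysis.FluidPDE.VectorCalculus
import Literature.Analysis.FluidPDE.SelfSimilar
import HarnessLib

/-!
# Octahedral symmetry: signed-permutation isometries (`B_n`, `O_h = B₃`) and `O_h`-equivariant fields

Topic `Literature/Analysis/FluidPDE` (definition request `defn-IsOhEquivariant` of route
`CirculationRelay`, sub-problem NavierStokesRegularity; companion of `IsAxisymmetric` in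
`AxisymmetricEuler`).

The **full octahedral group** `O_h ≅ B₃ = S₄ × ℤ₂` (order `48`) is the group of linear isometries
of `ℝ³` permuting the signed coordinate axes `{±e₀, ±e₁, ±e₂}`: the `48` signed permutation
matrices `O(3) ∩ GL₃(ℤ)`. Elgindi–Jeong 2021, §1.1 (arXiv p. 3): the rotation group `𝒪` is
generated by the quarter turns `P₁, P₂, P₃` about the axes (order `24`), the *extended* group
`𝒪̃ = ⟨Pᵢ, Rᵢ⟩` adds the coordinate reflections `R₁(x) = (−x₁, x₂, x₃)`, … and "has 48 elements";
its fundamental domain (Weyl chamber of `B₃`) is `Ũ = {x₁ > x₂ > x₃ > 0}`. Def. 1.1 ibid.: a vector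
field `f : ℝ³ → ℝ³` is *symmetric* with respect to a rotation `O` if `f (O x) = O (f x)`, and *even
symmetric* with respect to a reflection `R` if `f (R x) = R (f x)`; even symmetry under all of `𝒪̃`
is the symmetry class of Kida's "high-symmetric" flows (Kida 1985; Boratav–Pelz 1994; Pelz 2001;
Elgindi–Jeong p. 4: "the set of symmetries `𝒪̃` coincide with those used in the so-called high
symmetry flows of Kida"), here called **`O_h`-equivariance**.

## Main definitions

* `Literature.Analysis.FluidPDE.IsSignedPermIsometry g` (any finite index type `ι`): the linear
  isometry `g` of `EuclideanSpace ℝ ι` maps every basis vector `eᵢ` to some `±eⱼ` (the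
  hyperoctahedral group `B_n`, `n = |ι|`); `Literature.Analysis.FluidPDE.signedPermIsometry σ s`,
  `(g x)ⱼ = sⱼ x_{σ j}`, the explicit elements; `mirrorReflection k` (`x_k ↦ −x_k`) and
  `swapReflection k l` (`x_k ↔ x_l`), the reflections in the coordinate and diagonal mirrors.
* `Literature.Analysis.FluidPDE.IsOctahedralIsometry g` (`ι = Fin 3`, an `abbrev`), and
  `Literature.Analysis.FluidPDE.IsOhEquivariant v := ∀ g, IsOctahedralIsometry g → ∀ x, v (g x) = g (v x)`.
  Both unfold (`Iff.rfl`: `isOctahedralIsometry_iff`, `isOhEquivariant_iff`,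
  `forall_isOhEquivariant_iff`) to the clauses inlined **verbatim** in the route decls
  `OhRelayProfileExists`, `OhTruncationBridge`, `OhTypeIDssLiouville`, `RelayThesis` of
  `Summits/NavierStokesRegularity/NavierStokesRegularity/Theses/CirculationRelay.lean`, so that a
  later restate can use the named notions without changing meaning.

## Main statements (all proved)

* group structure: `IsSignedPermIsometry.refl/.trans/.symm`, `isSignedPermIsometry_neg` (`−1 ∈ O_h`),
  `isSignedPermIsometry_signedPermIsometry`, the classification
  `isSignedPermIsometry_iff : IsSignedPermIsometry g ↔ ∃ σ s, g = signedPermIsometry σ s`,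
  the parametrisation `signedPermIsometryEquiv : Perm ι × (ι → ℤˣ) ≃ {g // IsSignedPermIsometry g}`
  and the orders `card_isSignedPermIsometry = 2ⁿ · n!`, `card_isOctahedralIsometry = 48`.
* equivariant fields: `IsOhEquivariant.zero/.add/.smul/.neg`, oddness `IsOhEquivariant.apply_neg`
  and `IsOhEquivariant.apply_zero` (`v 0 = 0`), invariance under the Navier–Stokes scaling
  (`IsOhEquivariant.nsRescaleData`, `IsOhEquivariant.nsRescale`), collapse of rotated discrete
  self-similarity with phase in `O_h` to plain DSS (`isRotatedDSS_iff_isDiscretelySelfSimilar`),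
  and **Schur's lemma at the apex**: a linear map commuting with `O_h` is scalar
  (`exists_eq_smul_of_forall_isSignedPermIsometry`), hence `fderiv ℝ v 0 = c • id` for an
  equivariant `v` and `fderiv ℝ v 0 = 0` if moreover `div v (0) = 0`
  (`IsOhEquivariant.fderiv_zero_eq_zero`).

Navier–Stokes specific consequences (propagation of `O_h`-equivariance by the classical flow,
vorticity normal to the mirror planes) are in the companion file `OctahedralSymmetryNS`.

## Mathlib / tree search

Mathlib (this pin) has no hyperoctahedral group or signed permutation matrices as such
(searched `ctahedral`, `signedPerm`, `hyperoctahedral`); used: `LinearIsometryEquiv`,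
`EuclideanSpace.single` (= `PiLp.single 2`), `EuclideanSpace.basisFun`, `Basis.ext'`,
`Finite.injective_iff_bijective`, `Nat.card_perm`, `Nat.card_fun`, `Fintype.card_units_int`,
`ContinuousLinearEquiv.comp_right_fderiv`/`comp_fderiv`, `LinearMap.trace_id`. In the tree,
`DuchonRobert.cubeSymmVec σ s` is the same map `(B v)ⱼ = sⱼ v_{σ j}` as a bare function on the
torus side (not imported); `EyinkBalanceLimits.coordFlip/coordSwap` are the two reflections as
ad hoc isometries in an analysis file (not imported; names avoided).

## References

* T. M. Elgindi, I.-J. Jeong, *The incompressible Euler equations under octahedral symmetry: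
  singularity formation in a fundamental domain*, Adv. Math. 393 (2021) 108091, §1.1, Def. 1.1,
  Prop. 1.2 (arXiv:2001.07840, pp. 3–4). [ElgindiJeong2021]
* S. Kida, *Three-dimensional periodic flows with high-symmetry*, J. Phys. Soc. Japan 54 (1985)
  2132–2136. [Kida1985]
* O. N. Boratav, R. B. Pelz, Phys. Fluids 6 (1994) 2757–2784 [BoratavPelz1994]; R. B. Pelz,
  *Symmetry and the hydrodynamic blow-up problem*, J. Fluid Mech. 444 (2001) 299–320 [Pelz2001].
-/

noncomputable section

open Function Set
open scoped InnerProductSpace RealInnerProductSpace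

namespace Literature.Analysis.FluidPDE

/-! ### Units of `ℤ` as real signs -/

/-- A sign `u ∈ ℤˣ = {±1}` squares to `1` in `ℝ`. [folklore] -/
theorem intUnits_cast_mul_self (u : ℤˣ) : ((u : ℤ) : ℝ) * ((u : ℤ) : ℝ) = 1 := by
  rcases Int.units_eq_one_or u with rfl | rfl <;> simp

/-- A sign `u ∈ ℤˣ = {±1}` has norm `1` in `ℝ`. [folklore] -/
theorem norm_intUnits_cast (u : ℤˣ) : ‖((u : ℤ) : ℝ)‖ = 1 := by
  rcases Int.units_eq_one_or u with rfl | rfl <;> simp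

/-- A sign `u ∈ ℤˣ = {±1}` is nonzero in `ℝ`. [folklore] -/
theorem intUnits_cast_ne_zero (u : ℤˣ) : ((u : ℤ) : ℝ) ≠ 0 := by
  rcases Int.units_eq_one_or u with rfl | rfl <;> simp

/-! ### Signed-permutation isometries of `ℝ^ι` (the hyperoctahedral group `B_n`) -/

section SignedPerm

variable {ι : Type*} [Fintype ι]

/-- The **signed permutation** `(g x)ⱼ = sⱼ · x_{σ j}` of `ℝ^ι` attached to a permutation `σ` of
the coordinates and signs `s : ι → ℤˣ`, as a linear isometry equivalence (the same formula as
the torus-side `DuchonRobert.cubeSymmVec`; Elgindi–Jeong 2021, §1.1: `P₃(x) = (−x₂, x₁, x₃)`,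
`R₁(x) = (−x₁, x₂, x₃)`, …). It sends `eᵢ` to `s_{σ⁻¹ i} e_{σ⁻¹ i}`
(`signedPermIsometry_single`). [cite: ElgindiJeong2021, §1.1 (arXiv p. 3)] -/
def signedPermIsometry (σ : Equiv.Perm ι) (s : ι → ℤˣ) :
    EuclideanSpace ℝ ι ≃ₗᵢ[ℝ] EuclideanSpace ℝ ι where
  toFun x := WithLp.toLp 2 fun j => ((s j : ℤ) : ℝ) * x (σ j)
  invFun y := WithLp.toLp 2 fun i => ((s (σ.symm i) : ℤ) : ℝ) * y (σ.symm i)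
  map_add' x y := by
    ext j
    simp [mul_add]
  map_smul' c x := by
    ext j
    simp [mul_left_comm]
  left_inv x := by
    ext i
    simp only [Equiv.apply_symm_apply]
    rw [← mul_assoc, intUnits_cast_mul_self, one_mul]
  right_inv y := by
    ext j
    simp only [Equiv.symm_apply_apply]
    rw [← mul_assoc, intUnits_cast_mul_self, one_mul]
  norm_map' x := by
    change ‖WithLp.toLp 2 (fun j => ((s j : ℤ) : ℝ) * x (σ j))‖ = ‖x‖
    rw [EuclideanSpace.norm_eq, EuclideanSpace.norm_eq]
    congr 1
    calc ∑ j, ‖(WithLp.toLp 2 fun j => ((s j : ℤ) : ℝ) * x (σ j)) j‖ ^ 2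
        = ∑ j, ‖x (σ j)‖ ^ 2 := by
          refine Finset.sum_congr rfl fun j _ => ?_
          rw [PiLp.toLp_apply, norm_mul, norm_intUnits_cast, one_mul]
      _ = ∑ i, ‖x i‖ ^ 2 := Equiv.sum_comp σ (fun i => ‖x i‖ ^ 2)

/-- Coordinates of a signed permutation: `(g x)ⱼ = sⱼ x_{σ j}`. [folklore] -/
@[simp]
theorem signedPermIsometry_apply (σ : Equiv.Perm ι) (s : ι → ℤˣ) (x : EuclideanSpace ℝ ι)
    (j : ι) : signedPermIsometry σ s x j = ((s j : ℤ) : ℝ) * x (σ j) :=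
  rfl

/-- Coordinates of the inverse signed permutation: `(g⁻¹ y)ᵢ = s_{σ⁻¹ i} y_{σ⁻¹ i}`. [folklore] -/
@[simp]
theorem signedPermIsometry_symm_apply (σ : Equiv.Perm ι) (s : ι → ℤˣ) (y : EuclideanSpace ℝ ι)
    (i : ι) : (signedPermIsometry σ s).symm y i = ((s (σ.symm i) : ℤ) : ℝ) * y (σ.symm i) :=
  rfl

/-- The inverse of a signed permutation is the signed permutation `(σ⁻¹, s ∘ σ⁻¹)`. [folklore] -/
theorem signedPermIsometry_symm (σ : Equiv.Perm ι) (s : ι → ℤˣ) :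
    (signedPermIsometry σ s).symm = signedPermIsometry σ.symm (s ∘ σ.symm) := by
  ext y i
  rfl

/-- Composition of signed permutations: first `(σ, s)` then `(τ, t)` is
`(τ.trans σ, k ↦ t_k s_{τ k})`. [folklore] -/
theorem signedPermIsometry_trans (σ τ : Equiv.Perm ι) (s t : ι → ℤˣ) :
    (signedPermIsometry σ s).trans (signedPermIsometry τ t) =
      signedPermIsometry (τ.trans σ) (fun k => t k * s (τ k)) := by
  ext x k
  simp [mul_assoc]

variable [DecidableEq ι]

/-- A linear isometry `g` of `ℝ^ι = EuclideanSpace ℝ ι` is a **signed permutation** (an element of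
the hyperoctahedral group `B_n = O(n) ∩ GL_n(ℤ)`, `n = |ι|`) if it maps every coordinate vector
`eᵢ` to `±eⱼ` for some `j` (Elgindi–Jeong 2021, §1.1: for `n = 3` the extended octahedral group
`𝒪̃ = ⟨Pᵢ, Rᵢ⟩` of `48` elements; `isSignedPermIsometry_iff` identifies these with the maps
`(g x)ⱼ = sⱼ x_{σ j}`). [cite: ElgindiJeong2021, §1.1 (arXiv p. 3)] -/
def IsSignedPermIsometry (g : EuclideanSpace ℝ ι ≃ₗᵢ[ℝ] EuclideanSpace ℝ ι) : Prop :=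
  ∀ i : ι, ∃ j : ι, g (EuclideanSpace.single i 1) = EuclideanSpace.single j 1 ∨
    g (EuclideanSpace.single i 1) = -EuclideanSpace.single j 1

/-- A signed permutation sends the coordinate vector `eᵢ` to `s_{σ⁻¹ i} • e_{σ⁻¹ i}`. [folklore] -/
theorem signedPermIsometry_single (σ : Equiv.Perm ι) (s : ι → ℤˣ) (i : ι) :
    signedPermIsometry σ s (EuclideanSpace.single i 1) =
      ((s (σ.symm i) : ℤ) : ℝ) • EuclideanSpace.single (σ.symm i) 1 := by
  ext j
  simp only [signedPermIsometry_apply, PiLp.single_apply, PiLp.smul_apply, smul_eq_mul,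
    Equiv.apply_eq_iff_eq_symm_apply]
  split_ifs with h
  · subst h
    simp
  · simp

/-- Signed permutations are signed-permutation isometries: `eᵢ ↦ ±e_{σ⁻¹ i}`. [folklore] -/
theorem isSignedPermIsometry_signedPermIsometry (σ : Equiv.Perm ι) (s : ι → ℤˣ) :
    IsSignedPermIsometry (signedPermIsometry σ s) := by
  intro i
  refine ⟨σ.symm i, ?_⟩
  rw [signedPermIsometry_single]
  rcases Int.units_eq_one_or (s (σ.symm i)) with h | h
  · left
    simp [h]
  · right
    simp [h]

/-- The identity is a signed permutation. [folklore] -/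
theorem IsSignedPermIsometry.refl :
    IsSignedPermIsometry (LinearIsometryEquiv.refl ℝ (EuclideanSpace ℝ ι)) :=
  fun i => ⟨i, Or.inl rfl⟩

/-- `−1` (the central inversion `x ↦ −x`) is a signed permutation. [folklore] -/
theorem isSignedPermIsometry_neg :
    IsSignedPermIsometry (LinearIsometryEquiv.neg ℝ : EuclideanSpace ℝ ι ≃ₗᵢ[ℝ] EuclideanSpace ℝ ι) :=
  fun i => ⟨i, Or.inr (by simp)⟩

/-- Signed permutations are closed under composition (`g` first, then `h`). [folklore] -/
theorem IsSignedPermIsometry.trans {g h : EuclideanSpace ℝ ι ≃ₗᵢ[ℝ] EuclideanSpace ℝ ι}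
    (hg : IsSignedPermIsometry g) (hh : IsSignedPermIsometry h) :
    IsSignedPermIsometry (g.trans h) := by
  intro i
  obtain ⟨j, hj⟩ := hg i
  obtain ⟨k, hk⟩ := hh j
  refine ⟨k, ?_⟩
  simp only [LinearIsometryEquiv.trans_apply]
  rcases hj with hj | hj <;> rcases hk with hk | hk <;> simp [hj, hk, map_neg]

/-- Two linear isometry equivalences of `ℝ^ι` that agree on the coordinate vectors are equal. [folklore] -/
theorem linearIsometryEquiv_eq_of_apply_single
    {g h : EuclideanSpace ℝ ι ≃ₗᵢ[ℝ] EuclideanSpace ℝ ι}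
    (H : ∀ i, g (EuclideanSpace.single i 1) = h (EuclideanSpace.single i 1)) : g = h := by
  apply LinearIsometryEquiv.toLinearEquiv_injective
  exact (EuclideanSpace.basisFun ι ℝ).toBasis.ext' fun i => by
    simpa only [OrthonormalBasis.coe_toBasis, EuclideanSpace.basisFun_apply,
      LinearIsometryEquiv.coe_toLinearEquiv] using H i

/-- **Classification.** Every signed-permutation isometry is one of the explicit maps
`signedPermIsometry σ s`: the assignment `eᵢ ↦ ±e_{τ i}` has `τ` injective (an isometry preserves
the orthogonality of distinct `eᵢ`), hence bijective, and a linear map is determined by the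
basis. [folklore] -/
theorem IsSignedPermIsometry.exists_eq_signedPermIsometry
    {g : EuclideanSpace ℝ ι ≃ₗᵢ[ℝ] EuclideanSpace ℝ ι} (hg : IsSignedPermIsometry g) :
    ∃ (σ : Equiv.Perm ι) (s : ι → ℤˣ), g = signedPermIsometry σ s := by
  classical
  choose τ hτ using hg
  -- the signs
  set ε : ι → ℤˣ := fun i =>
    if g (EuclideanSpace.single i 1) = EuclideanSpace.single (τ i) 1 then 1 else -1 with hε
  have hgε : ∀ i, g (EuclideanSpace.single i 1) =
      ((ε i : ℤ) : ℝ) • EuclideanSpace.single (τ i) 1 := by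
    intro i
    by_cases h : g (EuclideanSpace.single i 1) = EuclideanSpace.single (τ i) 1
    · have hεi : ε i = 1 := by
        simp only [hε]
        exact if_pos h
      rw [hεi, h]
      simp
    · have hεi : ε i = -1 := by
        simp only [hε]
        exact if_neg h
      rw [hεi, (hτ i).resolve_left h]
      simp
  -- `τ` is injective: `⟪g eᵢ, g eᵢ'⟫ = ⟪eᵢ, eᵢ'⟫ = 0` for `i ≠ i'`, but `= ±1` if `τ i = τ i'`
  have hinj : Injective τ := by
    intro i i' hii'
    by_contra hne
    have h0 : ⟪g (EuclideanSpace.single i 1), g (EuclideanSpace.single i' 1)⟫_ℝ = 0 := by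
      rw [LinearIsometryEquiv.inner_map_map, EuclideanSpace.inner_single_left, PiLp.single_apply,
        if_neg hne]
      simp
    rw [hgε i, hgε i', real_inner_smul_left, real_inner_smul_right,
      EuclideanSpace.inner_single_left, hii', PiLp.single_apply, if_pos rfl] at h0
    simp only [map_one, mul_one, mul_eq_zero] at h0
    rcases h0 with h0 | h0
    · exact intUnits_cast_ne_zero _ h0
    · exact intUnits_cast_ne_zero _ h0
  have hbij : Bijective τ := Finite.injective_iff_bijective.1 hinj
  refine ⟨(Equiv.ofBijective τ hbij).symm, fun j => ε ((Equiv.ofBijective τ hbij).symm j),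
    linearIsometryEquiv_eq_of_apply_single fun i => ?_⟩
  rw [hgε i, signedPermIsometry_single]
  simp only [Equiv.symm_symm, Equiv.ofBijective_symm_apply_apply, Equiv.ofBijective_apply]

/-- **Characterisation of the hyperoctahedral group**: a linear isometry of `ℝ^ι` permutes the
signed coordinate axes iff it is one of the `2ⁿ n!` signed permutations `(g x)ⱼ = sⱼ x_{σ j}`
(Elgindi–Jeong 2021, §1.1: `𝒪̃ = ⟨Pᵢ, Rᵢ⟩`, `48` elements for `n = 3`). [cite: ElgindiJeong2021, §1.1 (arXiv p. 3)] -/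
theorem isSignedPermIsometry_iff (g : EuclideanSpace ℝ ι ≃ₗᵢ[ℝ] EuclideanSpace ℝ ι) :
    IsSignedPermIsometry g ↔ ∃ (σ : Equiv.Perm ι) (s : ι → ℤˣ), g = signedPermIsometry σ s :=
  ⟨fun h => h.exists_eq_signedPermIsometry, by
    rintro ⟨σ, s, rfl⟩
    exact isSignedPermIsometry_signedPermIsometry σ s⟩

/-- Signed permutations are closed under inversion. [folklore] -/
theorem IsSignedPermIsometry.symm {g : EuclideanSpace ℝ ι ≃ₗᵢ[ℝ] EuclideanSpace ℝ ι}
    (hg : IsSignedPermIsometry g) : IsSignedPermIsometry g.symm := by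
  obtain ⟨σ, s, rfl⟩ := hg.exists_eq_signedPermIsometry
  rw [signedPermIsometry_symm]
  exact isSignedPermIsometry_signedPermIsometry _ _

/-- The parameters `(σ, s)` of a signed permutation are unique. [folklore] -/
theorem signedPermIsometry_injective {σ σ' : Equiv.Perm ι} {s s' : ι → ℤˣ}
    (h : signedPermIsometry σ s = signedPermIsometry σ' s') : σ = σ' ∧ s = s' := by
  have key : ∀ j, σ j = σ' j ∧ s j = s' j := by
    intro j
    have hj := congrArg (fun g => g (EuclideanSpace.single (σ j) 1) j) h
    simp only [signedPermIsometry_apply, PiLp.single_eq_same, mul_one] at hj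
    by_cases hσ : σ' j = σ j
    · rw [hσ, PiLp.single_eq_same, mul_one] at hj
      exact ⟨hσ.symm, Units.ext (by exact_mod_cast hj)⟩
    · rw [PiLp.single_eq_of_ne _ hσ, mul_zero] at hj
      exact absurd hj (intUnits_cast_ne_zero _)
  exact ⟨Equiv.ext fun j => (key j).1, funext fun j => (key j).2⟩

/-- The hyperoctahedral group is parametrised by `Perm ι × (ι → ℤˣ)` (the wreath product
`ℤ₂ ≀ Sₙ` as a set). [folklore] -/
def signedPermIsometryEquiv :
    Equiv.Perm ι × (ι → ℤˣ) ≃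
      {g : EuclideanSpace ℝ ι ≃ₗᵢ[ℝ] EuclideanSpace ℝ ι // IsSignedPermIsometry g} :=
  Equiv.ofBijective
    (fun p => ⟨signedPermIsometry p.1 p.2, isSignedPermIsometry_signedPermIsometry p.1 p.2⟩)
    ⟨fun p q hpq => by
      obtain ⟨h1, h2⟩ := signedPermIsometry_injective (congrArg Subtype.val hpq)
      exact Prod.ext h1 h2,
     fun g => by
      obtain ⟨σ, s, hs⟩ := g.2.exists_eq_signedPermIsometry
      exact ⟨(σ, s), Subtype.ext hs.symm⟩⟩

/-- **Order of the hyperoctahedral group**: there are exactly `2ⁿ · n!` signed-permutation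
isometries of `ℝⁿ` (`48` for `n = 3`, Elgindi–Jeong 2021, §1.1). [cite: ElgindiJeong2021, §1.1 (arXiv p. 3)] -/
theorem card_isSignedPermIsometry :
    Nat.card {g : EuclideanSpace ℝ ι ≃ₗᵢ[ℝ] EuclideanSpace ℝ ι // IsSignedPermIsometry g} =
      2 ^ Fintype.card ι * (Fintype.card ι).factorial := by
  rw [← Nat.card_congr signedPermIsometryEquiv, Nat.card_prod, Nat.card_perm, Nat.card_fun,
    Nat.card_eq_fintype_card (α := ℤˣ), Fintype.card_units_int, Nat.card_eq_fintype_card,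
    mul_comm]

/-! #### The mirrors: coordinate reflections and transpositions -/

/-- The **reflection in the coordinate hyperplane `{x_k = 0}`**: `x_k ↦ −x_k`, other coordinates
fixed (Elgindi–Jeong 2021, §1.1: `R₁, R₂, R₃`). [cite: ElgindiJeong2021, §1.1 (arXiv p. 3)] -/
def mirrorReflection (k : ι) : EuclideanSpace ℝ ι ≃ₗᵢ[ℝ] EuclideanSpace ℝ ι :=
  signedPermIsometry 1 fun j => if j = k then -1 else 1

/-- Coordinates of the coordinate reflection. [folklore] -/
@[simp]
theorem mirrorReflection_apply (k : ι) (x : EuclideanSpace ℝ ι) (j : ι) :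
    mirrorReflection k x j = if j = k then -x j else x j := by
  simp only [mirrorReflection, signedPermIsometry_apply, Equiv.Perm.coe_one, id_eq]
  split_ifs <;> simp

/-- The coordinate reflections belong to the hyperoctahedral group. [folklore] -/
theorem isSignedPermIsometry_mirrorReflection (k : ι) :
    IsSignedPermIsometry (mirrorReflection k) :=
  isSignedPermIsometry_signedPermIsometry _ _

/-- The **reflection in the diagonal hyperplane `{x_k = x_l}`**: the transposition of the
coordinates `k` and `l` (for `k = l` the identity). [folklore] -/
def swapReflection (k l : ι) : EuclideanSpace ℝ ι ≃ₗᵢ[ℝ] EuclideanSpace ℝ ι :=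
  signedPermIsometry (Equiv.swap k l) fun _ => 1

/-- Coordinates of the transposition. [folklore] -/
@[simp]
theorem swapReflection_apply (k l : ι) (x : EuclideanSpace ℝ ι) (j : ι) :
    swapReflection k l x j = x (Equiv.swap k l j) := by
  simp [swapReflection]

/-- The transpositions belong to the hyperoctahedral group. [folklore] -/
theorem isSignedPermIsometry_swapReflection (k l : ι) :
    IsSignedPermIsometry (swapReflection k l) :=
  isSignedPermIsometry_signedPermIsometry _ _

/-! #### Schur's lemma for the standard representation -/

/-- **Schur's lemma for `B_n` on `ℝⁿ`.** A linear map commuting with every signed permutation is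
a scalar: commuting with the reflection `x_k ↦ −x_k` kills the off-diagonal entries of column
`k`, commuting with the transpositions equalises the diagonal (the standard representation of
`B_n`, `n ≥ 1`, is absolutely irreducible). [folklore] -/
theorem exists_eq_smul_of_forall_isSignedPermIsometry
    {L : EuclideanSpace ℝ ι →L[ℝ] EuclideanSpace ℝ ι}
    (hL : ∀ g : EuclideanSpace ℝ ι ≃ₗᵢ[ℝ] EuclideanSpace ℝ ι, IsSignedPermIsometry g →
      ∀ x, L (g x) = g (L x)) :
    ∃ c : ℝ, ∀ x, L x = c • x := by
  -- off-diagonal entries vanish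
  have hoff : ∀ k j, j ≠ k → L (EuclideanSpace.single k 1) j = 0 := by
    intro k j hjk
    have h := congrArg (fun y : EuclideanSpace ℝ ι => y j)
      (hL _ (isSignedPermIsometry_mirrorReflection k) (EuclideanSpace.single k 1))
    have hMk : mirrorReflection k (EuclideanSpace.single k 1) = -EuclideanSpace.single k 1 := by
      ext i
      by_cases hi : i = k <;> simp [hi]
    simp only [hMk, map_neg, PiLp.neg_apply, mirrorReflection_apply, if_neg hjk] at h
    linarith
  -- diagonal entries agree
  have hdiag : ∀ k l, L (EuclideanSpace.single k 1) k = L (EuclideanSpace.single l 1) l := by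
    intro k l
    have h := congrArg (fun y : EuclideanSpace ℝ ι => y l)
      (hL _ (isSignedPermIsometry_swapReflection k l) (EuclideanSpace.single k 1))
    have hS : swapReflection k l (EuclideanSpace.single k 1) = EuclideanSpace.single l 1 := by
      ext i
      simp only [swapReflection_apply, PiLp.single_apply]
      by_cases hi : i = l
      · subst hi
        simp
      · by_cases hik : i = k
        · subst hik
          simp [Equiv.swap_apply_left, Ne.symm hi, hi]
        · simp [Equiv.swap_apply_of_ne_of_ne hik hi, hik, hi]
    simp only [hS, swapReflection_apply, Equiv.swap_apply_right] at h
    exact h.symm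
  -- assemble
  cases isEmpty_or_nonempty ι with
  | inl hι =>
    refine ⟨0, fun x => ?_⟩
    ext j
    exact (IsEmpty.false j).elim
  | inr hι =>
    obtain ⟨k₀⟩ := hι
    -- on the basis
    have key : ∀ k, L (EuclideanSpace.single k 1) =
        L (EuclideanSpace.single k₀ 1) k₀ • EuclideanSpace.single k 1 := by
      intro k
      ext j
      by_cases hjk : j = k
      · subst hjk
        simp [hdiag j k₀]
      · simp [hoff k j hjk, hjk]
    -- hence everywhere, by linearity
    refine ⟨L (EuclideanSpace.single k₀ 1) k₀, fun x => ?_⟩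
    have h : (L : EuclideanSpace ℝ ι →ₗ[ℝ] EuclideanSpace ℝ ι) =
        L (EuclideanSpace.single k₀ 1) k₀ • LinearMap.id :=
      (EuclideanSpace.basisFun ι ℝ).toBasis.ext fun k => by
        simp [key k]
    simpa using LinearMap.congr_fun h x

end SignedPerm

/-! ### The full octahedral group `O_h` and `O_h`-equivariant vector fields on `ℝ³` -/

section Octahedral

/-- Local notation for physical space `ℝ³ = EuclideanSpace ℝ (Fin 3)`. -/
local notation "ℝ³" => EuclideanSpace ℝ (Fin 3)

/-- A linear isometry `g` of `ℝ³` is **octahedral** (an element of the full octahedral group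
`O_h = B₃`, the `48` signed permutation matrices `O(3) ∩ GL₃(ℤ)`; Elgindi–Jeong 2021, §1.1, the
extended group `𝒪̃ = ⟨P₁, P₂, P₃, R₁, R₂, R₃⟩`, "`𝒪̃` has 48 elements") if it maps each coordinate
vector `eᵢ` to some `±eⱼ`. This is `IsSignedPermIsometry` for `ι = Fin 3` and unfolds by `Iff.rfl`
to the clause inlined in route CirculationRelay (`isOctahedralIsometry_iff`). [cite: ElgindiJeong2021, §1.1 (arXiv p. 3)] -/
abbrev IsOctahedralIsometry (g : ℝ³ ≃ₗᵢ[ℝ] ℝ³) : Prop :=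
  IsSignedPermIsometry g

/-- `IsOctahedralIsometry g` is, verbatim, the signed-axis clause of route CirculationRelay. [folklore] -/
theorem isOctahedralIsometry_iff (g : ℝ³ ≃ₗᵢ[ℝ] ℝ³) :
    IsOctahedralIsometry g ↔
      ∀ i : Fin 3, ∃ j : Fin 3, g (EuclideanSpace.single i 1) = EuclideanSpace.single j 1 ∨
        g (EuclideanSpace.single i 1) = -EuclideanSpace.single j 1 :=
  Iff.rfl

/-- **`|O_h| = 48`** (Elgindi–Jeong 2021, §1.1: "`𝒪̃` has 48 elements"). [cite: ElgindiJeong2021, §1.1 (arXiv p. 3)] -/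
theorem card_isOctahedralIsometry :
    Nat.card {g : ℝ³ ≃ₗᵢ[ℝ] ℝ³ // IsOctahedralIsometry g} = 48 :=
  (card_isSignedPermIsometry (ι := Fin 3)).trans (by simp [Nat.factorial])

/-- Elgindi–Jeong's generators `P₃(x) = (−x₂, x₁, x₃)` (quarter turn about the `x₃`-axis) and
`R₁(x) = (−x₁, x₂, x₃)` are octahedral; in `signedPermIsometry` form `P₃ = (swap 0 1, (−1, 1, 1))`
and `R₁ = mirrorReflection 0`. [cite: ElgindiJeong2021, §1.1 (arXiv p. 3)] -/
theorem isOctahedralIsometry_generators :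
    IsOctahedralIsometry (signedPermIsometry (Equiv.swap 0 1) ![-1, 1, 1]) ∧
      IsOctahedralIsometry (mirrorReflection (0 : Fin 3)) :=
  ⟨isSignedPermIsometry_signedPermIsometry _ _, isSignedPermIsometry_mirrorReflection _⟩

/-- A vector field `v : ℝ³ → ℝ³` is **`O_h`-equivariant** (octahedrally symmetric; Elgindi–Jeong
2021, Def. 1.1: "symmetric" `f (O x) = O (f x)` for the rotations and "even symmetric"
`f (R x) = R (f x)` for the reflections of `𝒪̃`; the symmetry class of Kida's high-symmetric
flows, Kida 1985, Pelz 2001, Elgindi–Jeong p. 4) if `v (g x) = g (v x)` for every octahedral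
isometry `g` and every `x`. Unfolds by `Iff.rfl` to the clause inlined in route CirculationRelay
(`isOhEquivariant_iff`, `forall_isOhEquivariant_iff`). [cite: ElgindiJeong2021, §1.1 Def. 1.1 (arXiv p. 3)] -/
def IsOhEquivariant (v : ℝ³ → ℝ³) : Prop :=
  ∀ g : ℝ³ ≃ₗᵢ[ℝ] ℝ³, IsOctahedralIsometry g → ∀ x, v (g x) = g (v x)

/-- `IsOhEquivariant v` is, verbatim, the equivariance clause of route CirculationRelay
(`RelayThesis`, `OhTruncationBridge`: the datum `u 0`). [folklore] -/
theorem isOhEquivariant_iff (v : ℝ³ → ℝ³) :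
    IsOhEquivariant v ↔
      ∀ g : EuclideanSpace ℝ (Fin 3) ≃ₗᵢ[ℝ] EuclideanSpace ℝ (Fin 3),
        (∀ i : Fin 3, ∃ j : Fin 3, g (EuclideanSpace.single i 1) = EuclideanSpace.single j 1 ∨
          g (EuclideanSpace.single i 1) = -EuclideanSpace.single j 1) →
        ∀ x, v (g x) = g (v x) :=
  Iff.rfl

/-- Time-dependent form: equivariance of every slice `u t`, `P t`, is the route's clause with the
isometry quantified first (`OhRelayProfileExists`, `OhTypeIDssLiouville`: `P t := t < 0`). [folklore] -/
theorem forall_isOhEquivariant_iff {α : Type*} (P : α → Prop) (u : α → ℝ³ → ℝ³) :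
    (∀ t, P t → IsOhEquivariant (u t)) ↔
      ∀ g : ℝ³ ≃ₗᵢ[ℝ] ℝ³, IsOctahedralIsometry g → ∀ t, P t → ∀ x, u t (g x) = g (u t x) :=
  ⟨fun h g hg t ht x => h t ht g hg x, fun h t ht g hg x => h g hg t ht x⟩

/-- The ancient-solution form used verbatim by route CirculationRelay:
`(∀ t < 0, IsOhEquivariant (u t)) ↔ ∀ g, IsOctahedralIsometry g → ∀ t < 0, ∀ x, u t (g x) = g (u t x)`. [folklore] -/
theorem forall_neg_isOhEquivariant_iff (u : ℝ → ℝ³ → ℝ³) :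
    (∀ t < 0, IsOhEquivariant (u t)) ↔
      ∀ g : EuclideanSpace ℝ (Fin 3) ≃ₗᵢ[ℝ] EuclideanSpace ℝ (Fin 3),
        (∀ i : Fin 3, ∃ j : Fin 3, g (EuclideanSpace.single i 1) = EuclideanSpace.single j 1 ∨
          g (EuclideanSpace.single i 1) = -EuclideanSpace.single j 1) →
        ∀ t < 0, ∀ x, u t (g x) = g (u t x) :=
  forall_isOhEquivariant_iff (fun t : ℝ => t < 0) u

/-- Equivariance can be tested on the `48` explicit signed permutations. [folklore] -/
theorem isOhEquivariant_iff_signedPermIsometry (v : ℝ³ → ℝ³) :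
    IsOhEquivariant v ↔ ∀ (σ : Equiv.Perm (Fin 3)) (s : Fin 3 → ℤˣ) (x : ℝ³),
      v (signedPermIsometry σ s x) = signedPermIsometry σ s (v x) := by
  constructor
  · intro h σ s x
    exact h _ (isSignedPermIsometry_signedPermIsometry σ s) x
  · intro h g hg x
    obtain ⟨σ, s, rfl⟩ := hg.exists_eq_signedPermIsometry
    exact h σ s x

namespace IsOhEquivariant

variable {v w : ℝ³ → ℝ³}

/-- The zero field is equivariant. [folklore] -/
theorem zero : IsOhEquivariant (0 : ℝ³ → ℝ³) := fun g _ x => by simp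

/-- Sums of equivariant fields are equivariant. [folklore] -/
theorem add (hv : IsOhEquivariant v) (hw : IsOhEquivariant w) : IsOhEquivariant (v + w) :=
  fun g hg x => by simp [hv g hg x, hw g hg x]

/-- Scalar multiples of equivariant fields are equivariant. [folklore] -/
theorem smul (hv : IsOhEquivariant v) (c : ℝ) : IsOhEquivariant (c • v) :=
  fun g hg x => by simp [hv g hg x]

/-- Negatives of equivariant fields are equivariant. [folklore] -/
theorem neg (hv : IsOhEquivariant v) : IsOhEquivariant (-v) :=
  fun g hg x => by simp [hv g hg x]

/-- Differences of equivariant fields are equivariant. [folklore] -/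
theorem sub (hv : IsOhEquivariant v) (hw : IsOhEquivariant w) : IsOhEquivariant (v - w) :=
  fun g hg x => by simp [hv g hg x, hw g hg x]

/-- Equivariance under one more isometry: if `v` is equivariant then so is `x ↦ h⁻¹ (v (h x))`
for every octahedral `h` — and it equals `v`. [folklore] -/
theorem conj_eq (hv : IsOhEquivariant v) {h : ℝ³ ≃ₗᵢ[ℝ] ℝ³} (hh : IsOctahedralIsometry h) :
    (fun x => h.symm (v (h x))) = v :=
  funext fun x => by simp [hv h hh x]

/-- An equivariant field is **odd**: `v (−x) = −v x` (`−1 ∈ O_h`). [folklore] -/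
theorem apply_neg (hv : IsOhEquivariant v) (x : ℝ³) : v (-x) = -v x := by
  simpa using hv _ isSignedPermIsometry_neg x

/-- An equivariant field **vanishes at the centre of symmetry**: `v 0 = 0` (the apex of route
CirculationRelay's profile). [folklore] -/
theorem apply_zero (hv : IsOhEquivariant v) : v 0 = 0 := by
  have h := hv.apply_neg 0
  rw [neg_zero] at h
  -- `h : v 0 = -v 0`
  have h2 : (2 : ℝ) • v 0 = 0 := by
    rw [two_smul]
    nth_rewrite 2 [h]
    exact add_neg_cancel _
  exact (smul_eq_zero.1 h2).resolve_left two_ne_zero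

/-- Precomposition with a dilation preserves equivariance (`g` is linear). [folklore] -/
theorem comp_smul (hv : IsOhEquivariant v) (a : ℝ) : IsOhEquivariant fun x => v (a • x) :=
  fun g hg x => by
    show v (a • g x) = g (v (a • x))
    rw [← g.map_smul, hv g hg]

/-- **Scaling invariance**: the Navier–Stokes rescaling of data `x ↦ c • v (c x)` preserves
`O_h`-equivariance. [folklore] -/
theorem nsRescaleData (hv : IsOhEquivariant v) (c : ℝ) :
    IsOhEquivariant (FluidPDE.nsRescaleData c v) :=
  fun g hg x => by
    show c • v (c • g x) = g (c • v (c • x))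
    rw [← g.map_smul c x, hv g hg, g.map_smul]

/-- **Scaling invariance, space–time**: the slice at time `t` of the parabolic rescaling
`nsRescale c u` is equivariant as soon as the slice `u (c² t)` is. [folklore] -/
theorem nsRescale {u : ℝ → ℝ³ → ℝ³} {c t : ℝ} (h : IsOhEquivariant (u (c ^ 2 * t))) :
    IsOhEquivariant (FluidPDE.nsRescale c u t) :=
  fun g hg x => by
    show c • u (c ^ 2 * t) (c • g x) = g (c • u (c ^ 2 * t) (c • x))
    rw [← g.map_smul c x, h g hg, g.map_smul]

/-- For ancient fields (slices `t < 0`) and `c ≠ 0`, `nsRescale c` preserves equivariance of all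
negative-time slices (the setting of `OhRelayProfileExists`). [folklore] -/
theorem nsRescale_of_forall_neg {u : ℝ → ℝ³ → ℝ³} {c : ℝ} (hc : c ≠ 0)
    (h : ∀ t < 0, IsOhEquivariant (u t)) : ∀ t < 0, IsOhEquivariant (FluidPDE.nsRescale c u t) :=
  fun _ ht => (h _ (mul_neg_of_pos_of_neg (pow_pos (abs_pos.2 hc) 2 |>.trans_eq (by simp)) ht)).nsRescale

end IsOhEquivariant

/-- **Rotated DSS with phase in `O_h` is plain DSS on equivariant fields**: if every slice of `u`
is `O_h`-equivariant and `R ∈ O_h`, then `λ Rᵀ u(λ²t, λ R x) = u(t, x)` iff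
`λ u(λ² t, λ x) = u(t, x)` (`R` acts trivially; Chae–Wolf's `IsRotatedDSS` versus
`IsDiscretelySelfSimilar`). [folklore] -/
theorem isRotatedDSS_iff_isDiscretelySelfSimilar {u : ℝ → ℝ³ → ℝ³} {c : ℝ} {R : ℝ³ ≃ₗᵢ[ℝ] ℝ³}
    (hR : IsOctahedralIsometry R) (hu : ∀ t, IsOhEquivariant (u t)) :
    IsRotatedDSS c R u ↔ IsDiscretelySelfSimilar c u := by
  have key : ∀ t x, c • R.symm (u (c ^ 2 * t) (c • R x)) = FluidPDE.nsRescale c u t x := by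
    intro t x
    rw [nsRescale_apply, ← R.map_smul, hu _ R hR, R.symm_apply_apply]
  simp only [IsRotatedDSS, IsDiscretelySelfSimilar, key, funext_iff]

/-! #### Schur at the apex: `∇v(0)` is scalar, and vanishes for divergence-free `v` -/

namespace IsOhEquivariant

variable {v : ℝ³ → ℝ³}

/-- The derivative of an equivariant field intertwines the symmetry:
`Dv(g x) ∘ g = g ∘ Dv(x)` (chain rule on `v ∘ g = g ∘ v`; no differentiability hypothesis is
needed since `g` is a linear homeomorphism; Elgindi–Jeong 2021, proof of Prop. 1.2:
`O⁻¹ ∇f(Ox) O = ∇f(x)`). [cite: ElgindiJeong2021, §1.1 Prop. 1.2 (proof, arXiv p. 3)] -/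
theorem fderiv_comp_apply (hv : IsOhEquivariant v) {g : ℝ³ ≃ₗᵢ[ℝ] ℝ³} (hg : IsOctahedralIsometry g)
    (x w : ℝ³) : fderiv ℝ v (g x) (g w) = g (fderiv ℝ v x w) := by
  have h1 : (fun y => v (g y)) = fun y => g (v y) := funext (hv g hg)
  have h2 : fderiv ℝ (fun y => v (g y)) x = (fderiv ℝ v (g x)).comp (g : ℝ³ →L[ℝ] ℝ³) :=
    g.toContinuousLinearEquiv.comp_right_fderiv
  have h3 : fderiv ℝ (fun y => g (v y)) x = (g : ℝ³ →L[ℝ] ℝ³).comp (fderiv ℝ v x) :=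
    g.toContinuousLinearEquiv.comp_fderiv
  rw [h1, h3] at h2
  have h4 := congrArg (fun T : ℝ³ →L[ℝ] ℝ³ => T w) h2
  simpa using h4.symm

/-- **Schur at the apex.** The velocity gradient of an `O_h`-equivariant field at the centre of
symmetry commutes with `O_h`, hence is a scalar multiple of the identity. [folklore] -/
theorem exists_fderiv_zero_eq_smul (hv : IsOhEquivariant v) :
    ∃ c : ℝ, ∀ w, fderiv ℝ v 0 w = c • w :=
  exists_eq_smul_of_forall_isSignedPermIsometry fun g hg w => by
    simpa using hv.fderiv_comp_apply hg 0 w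

/-- **Flat apex.** An `O_h`-equivariant field with `div v (0) = 0` has `∇v(0) = 0` (the scalar
`c` has trace `3c = div v (0)`); with `v 0 = 0` (`apply_zero`) the field vanishes to second
order at the centre — the property "u = ∇u = 0 at the apex" used by route CirculationRelay. [folklore] -/
theorem fderiv_zero_eq_zero (hv : IsOhEquivariant v) (hdiv : VectorCalculus.divergence v 0 = 0) :
    fderiv ℝ v 0 = 0 := by
  obtain ⟨c, hc⟩ := hv.exists_fderiv_zero_eq_smul
  -- `div v (0) = tr (c • id) = 3c`
  have htr : VectorCalculus.divergence v 0 = 3 * c := by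
    rw [divergence_eq_sum_inner_fderiv (EuclideanSpace.basisFun (Fin 3) ℝ)]
    simp [EuclideanSpace.basisFun_apply, hc, EuclideanSpace.inner_single_left]
  have hc0 : c = 0 := by
    rw [hdiv] at htr
    linarith
  ext w i
  simp [hc, hc0]

end IsOhEquivariant

end Octahedral

end Literature.Analysis.FluidPDE
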